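import Summits.BirchSwinnertonDyer.BirchSwinnertonDyer.Theses.GenusKolyvaginAtTwo
import Literature.NumberTheory.EllipticCurves.SelmerGaloisAction

/-!
# Route `GenusKolyvaginAtTwo`, crux #3 `KolyvaginExactAtTwo` (stmt-BirchSwinnertonDyer-22137):
# the base case `M₀ = 0` at `p = 2` through NON-Kolyvagin "transposition-class" primes —
# the algebraic skeleton (helper, PROVED; seat `bsd-line-gk2-p2`, gen 4)

Memo ANALYSIS-22137 v5 (evidence on the item). At `p = 2` every derived class `c(n)` is
`τ`-INVARIANT (Gross 1991 Prop. 5.4 read mod `2`: `−1 ≡ 1`), so the pairing of `c(ℓ)` with a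
`τ`-invariant Selmer class at an inert prime `λ` vanishes identically (memo v4 §11, "blindness":
`⟨Res a, Res b⟩_{K_λ} = ⟨a, Cor Res b⟩_{ℚ_ℓ} = ⟨a, 2b⟩ = 0`). What the `K`-frame CAN still see is the
part of `Sel₂(E/K)` on which `Gal(K/ℚ) = ⟨τ⟩` acts non-trivially, and it sees it through primes `ℓ`
that are Kolyvagin primes in W. Zhang's CONGRUENCE sense (`ℓ ∤ 2Nd_K` inert in `K`, `2 ∣ ℓ + 1`,
`2 ∣ a_ℓ` — the certificate primes of the crux as typed, `Zhang2014.IsKolyvaginPrime … 2 ℓ`) but NOT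
in Kolyvagin's Frobenius sense (`Frob_ℓ|E[2]` is a transposition `w ≠ τ|E[2]`), subject to the parity
condition «exactly one of `4 ∣ ℓ + 1`, `4 ∣ a_ℓ`»:

* LOCAL CRITERION (Gross Prop. 6.2 (2) at `p = 2`, §1 below): the operator
  `φ = ((ℓ+1)/2)·Frob_ℓ − a_ℓ/2` on `Ẽ(𝔽_λ)` is `≡ Frob_ℓ` or `≡ 1 (mod 2·End)` under the parity
  condition, hence `φ(x) = 0 ⟹ x ∈ 2Ẽ(𝔽_λ)` (`exists_two_smul_of_sub_eq_zero`): a prime `λ` with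
  `ỹ_K ∉ 2Ẽ(𝔽_λ)` makes `d(ℓ)_λ ≠ 0`. No eigenspace and no cyclicity is used (this is where the
  printed argument needs `p` odd).
* CONSTRAINT (global duality over `K` at such a `λ`; `H¹_f(K_λ, E[2]) ≅ 𝔽₂²` because
  `E[2] ⊂ E(K_λ)`): `loc_λ Sel₂(E/K) ⊆ {0, t}`, `t = loc_λ κ_y ≠ 0`, and `t` is fixed by
  `w = Frob_ℓ` (it is a norm `(1 + w)x` from `ℚ_ℓ`). Since `loc_λ (τ s) = w · loc_λ s`, a class with
  `s + τ s = κ_y` would have `u = loc_λ s ∈ {0, t}` and `w u = u + t` — impossible (§2,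
  `ne_zero_and_ne_of_apply_eq_add`). Hence **`κ_y ∉ (1 + τ) Sel₂(E/K)`** granted one such prime
  (they have positive density by Čebotarev when `y_K ∉ 2E(K)`: `t = (1 + w)·κ_y^ℚ(Frob_ℓ)`).
* ASSEMBLY (§3, pure `𝔽₂[C₂]`-module algebra, `selmer_eq_zero_or_eq_of_invariants_of_not_trace`):
  if the `τ`-INVARIANT part of `Sel₂(E/K)` is `{0, κ_y}` — a statement about the pair
  `(E, E^{(d_K)})` over `ℚ` (inflation–restriction, `E(K)[2] = 0`), Kolyvagin 1989 Thm. B₂'s frame —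
  and `κ_y ∉ (1 + τ) Sel₂(E/K)`, then `Sel₂(E/K) = {0, κ_y}`: Gross's Prop. 2.3 at `p = 2`, i.e.
  the crux's conclusion `#Ш(E/K)[2^∞] = 1 = 2^{2·0}` in its base case `M₀ = 0`.
  §4 instantiates §3 on the tree's `Sel^(2)(E/K) ⊆ H¹(K, E[2])` with `τ = conjAct W c 2`
  (`selmerGroup_two_subset_pair_of_invariants_of_not_trace`, `natCard_selmerGroup_two_eq_two_of…`).

Helper for the crux item (`--supports stmt-BirchSwinnertonDyer-22137`). The two displayed inputs of
§4 are NOT proved here (the first is Kolyvagin's `ℚ`-side theory at `2` for both members of the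
pair plus the local defects at `q ∣ d_K`; the second is the transposition-prime argument above,
whose Galois-cohomological leaves — Kolyvagin's classes at `p = 2`, local Tate duality, Čebotarev —
are the subject of the next files). No summit, no leaf and no crux is proved by this file; BSD is
not proved by any of this.

References: [GrossLMS1991] §2 Prop. 2.3, Prop. 5.4, Prop. 6.2, Prop. 8.2, §9; [Kolyvagin1989Izv]
Thm. B₂ (§3); [McCallumLMS1991] Prop. 3.1, Cor. 3.2; Kriz–Li 2019 (Forum Math. Sigma 7, e15)
§4.1 and Remark 1.14 (the `2`-Selmer statement over `K` is "not known in general how to show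
directly").
-/

set_option linter.dupNamespace false

namespace Summit.BirchSwinnertonDyer.BirchSwinnertonDyer.Theorems.GenusExact

/-! ## §1 The local criterion at `p = 2` under the parity condition -/

section LocalCriterion

variable {A : Type*} [AddCommGroup A]

/-- **Parity form of Gross's Prop. 6.2 (2) at `p = 2`.** Let `F` be an automorphism of an additive
group `A` (the `ℓ`-power Frobenius on `Ẽ(𝔽_λ)`) and `u, v ∈ ℤ` of OPPOSITE parity
(`u = (ℓ+1)/2`, `v = a_ℓ/2`: exactly one of `4 ∣ ℓ+1`, `4 ∣ a_ℓ`). If `u·F x = v·x` (i.e. the point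
`Q̃ = φ(x)`, `φ = ((ℓ+1)Frob_ℓ − a_ℓ)/2`, vanishes) then `x ∈ 2A`. So for `x = ỹ_K ∉ 2Ẽ(𝔽_λ)` the
local class `d(ℓ)_λ` is non-zero — with no eigenspace decomposition and no cyclicity hypothesis
(the two uses of `p` odd in the printed proof). [cite: GrossLMS1991, §6 proof of Prop. 6.2 (2)] -/
theorem exists_two_smul_of_sub_eq_zero (F : A ≃+ A) {u v : ℤ}
    (huv : (Odd u ∧ Even v) ∨ (Even u ∧ Odd v)) {x : A} (h : u • F x - v • x = 0) :
    ∃ y : A, x = (2 : ℤ) • y := by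
  rw [sub_eq_zero] at h
  rcases huv with ⟨⟨a, ha⟩, ⟨b, hb⟩⟩ | ⟨⟨a, ha⟩, ⟨b, hb⟩⟩
  · -- `u = 2a + 1`, `v = b + b`: `F x = 2 (b x - a F x)`, and `x = F⁻¹ (F x)`.
    rw [ha, hb] at h
    refine ⟨F.symm (b • x - a • F x), ?_⟩
    apply F.injective
    rw [map_zsmul, F.apply_symm_apply]
    calc F x = (2 * a + 1) • F x - (2 * a) • F x := by module
      _ = (b + b) • x - (2 * a) • F x := by rw [h]
      _ = (2 : ℤ) • (b • x - a • F x) := by module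
  · -- `u = a + a`, `v = 2b + 1`: `x = 2 (a F x - b x)`.
    rw [ha, hb] at h
    refine ⟨a • F x - b • x, ?_⟩
    calc x = (2 * b + 1) • x - (2 * b) • x := by module
      _ = (a + a) • F x - (2 * b) • x := by rw [h]
      _ = (2 : ℤ) • (a • F x - b • x) := by module

/-- Contrapositive, the form used: if `x ∉ 2A` then `φ(x) = u·F x − v·x ≠ 0`.
[cite: GrossLMS1991, §6 proof of Prop. 6.2 (2)] -/
theorem sub_ne_zero_of_not_two_dvd (F : A ≃+ A) {u v : ℤ}
    (huv : (Odd u ∧ Even v) ∨ (Even u ∧ Odd v)) {x : A} (hx : ¬ ∃ y : A, x = (2 : ℤ) • y) :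
    u • F x - v • x ≠ 0 :=
  fun h ↦ hx (exists_two_smul_of_sub_eq_zero F huv h)

/-- The parity condition in terms of `ℓ` and `a_ℓ`: for `ℓ` odd and `a_ℓ` even, «exactly one of
`4 ∣ ℓ + 1`, `4 ∣ a_ℓ`» says that `(ℓ+1)/2` and `a_ℓ/2` have opposite parity. [folklore] -/
theorem parity_halves_of_xor {ℓ a : ℤ} (hℓ : Odd ℓ) (ha : Even a)
    (h : Xor ((4 : ℤ) ∣ ℓ + 1) ((4 : ℤ) ∣ a)) :
    (Odd ((ℓ + 1) / 2) ∧ Even (a / 2)) ∨ (Even ((ℓ + 1) / 2) ∧ Odd (a / 2)) := by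
  obtain ⟨m, hm⟩ := hℓ
  obtain ⟨b, hb⟩ := ha
  have h1 : (ℓ + 1) / 2 = m + 1 := by omega
  have h2 : a / 2 = b := by omega
  rw [h1, h2]
  have e1 : (4 : ℤ) ∣ ℓ + 1 ↔ Even (m + 1) := by
    constructor
    · rintro ⟨k, hk⟩; exact ⟨k, by omega⟩
    · rintro ⟨k, hk⟩; exact ⟨k, by omega⟩
  have e2 : (4 : ℤ) ∣ a ↔ Even b := by
    constructor
    · rintro ⟨k, hk⟩; exact ⟨k, by omega⟩
    · rintro ⟨k, hk⟩; exact ⟨k, by omega⟩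
  rw [e1, e2] at h
  rcases h with ⟨hm1, hb1⟩ | ⟨hb1, hm1⟩
  · exact Or.inr ⟨hm1, Int.not_even_iff_odd.mp hb1⟩
  · exact Or.inl ⟨Int.not_even_iff_odd.mp hm1, hb1⟩

end LocalCriterion

/-! ## §2 The local contradiction at a transposition-class prime -/

section LocalContradiction

variable {L : Type*} [AddCommGroup L]

/-- **No `loc_λ s` with `w u = u + t`, `t ≠ 0`, lies in `{0, t}`.** At an admissible prime `λ`
the local group `H¹_f(K_λ, E[2]) ≅ Ẽ(𝔽_λ)/2 ≅ 𝔽₂²` carries the Frobenius `w = Frob_ℓ` (conjugation by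
a lift of `τ` to the decomposition group), `t = loc_λ κ_y` and `u = loc_λ s`; `τ s = s + κ_y` gives
`w u = u + t`. If `u = 0` then `t = 0`; if `u = t` then `w t = t + t = 0`, so `t = 0` (`w` injective).
[cite: GrossLMS1991, §9 (the local evaluation at `λ`)] -/
theorem ne_zero_and_ne_of_apply_eq_add (w : L →+ L) (hw : Function.Injective w)
    (h2 : ∀ x : L, (2 : ℕ) • x = 0) {t u : L} (ht : t ≠ 0) (hwu : w u = u + t) :
    u ≠ 0 ∧ u ≠ t := by
  constructor
  · rintro rfl
    rw [map_zero, zero_add] at hwu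
    exact ht hwu.symm
  · rintro rfl
    have h0 : w u = 0 := by rw [hwu, ← two_nsmul, h2]
    exact ht (hw (by rw [h0, map_zero]))

/-- The hyperplane constraint and the trace relation are incompatible: if every Selmer
localisation lies in `{0, t}` with `t ≠ 0`, then no class `s` with `loc (τ s) = w (loc s)` can
have `loc s + loc (τ s) = t`. Abstract form with `loc : S → L` any map. [cite: GrossLMS1991, §9] -/
theorem not_trace_of_loc_subset_pair {S : Type*} (loc : S → L) (w : L →+ L)
    (hw : Function.Injective w) (h2 : ∀ x : L, (2 : ℕ) • x = 0) {t : L} (ht : t ≠ 0)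
    (hpair : ∀ s : S, loc s = 0 ∨ loc s = t) {s τs : S} (hτ : loc τs = w (loc s))
    (hsum : loc s + loc τs = t) : False := by
  have hwu : w (loc s) = loc s + t := by
    rw [← hτ, ← hsum, ← add_assoc, ← two_nsmul, h2, zero_add]
  obtain ⟨h0, h1⟩ := ne_zero_and_ne_of_apply_eq_add w hw h2 ht hwu
  rcases hpair s with h | h
  · exact h0 h
  · exact h1 h

end LocalContradiction

/-! ## §3 The `𝔽₂[C₂]`-module assembly -/

section Assembly

variable {V : Type*} [AddCommGroup V]

/-- **Assembly lemma.** Let `S` be a subgroup of a group `V` killed by `2` (`H¹(K, E[2])`),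
`τ` an additive involution of `V` preserving `S` (complex conjugation on `Sel₂(E/K)`), `κ ∈ S`.
If (i) every `τ`-invariant element of `S` is `0` or `κ` and (ii) `κ` is not of the form `s + τ s`
with `s ∈ S`, then `S ⊆ {0, κ}`. Proof: `s + τ s` is `τ`-invariant, so it is `0` or `κ`; (ii)
excludes `κ`; so `τ s = −s = s` and (i) applies. [folklore] -/
theorem selmer_eq_zero_or_eq_of_invariants_of_not_trace (S : AddSubgroup V) (τ : V →+ V)
    (hτ2 : ∀ x, τ (τ x) = x) (hτS : ∀ s ∈ S, τ s ∈ S) (h2 : ∀ x ∈ S, (2 : ℕ) • x = 0)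
    {κ : V} (hinv : ∀ s ∈ S, τ s = s → s = 0 ∨ s = κ) (htr : ∀ s ∈ S, s + τ s ≠ κ) :
    ∀ s ∈ S, s = 0 ∨ s = κ := by
  intro s hs
  have hfix : τ (s + τ s) = s + τ s := by rw [map_add, hτ2, add_comm]
  have hmem : s + τ s ∈ S := S.add_mem hs (hτS s hs)
  rcases hinv _ hmem hfix with h0 | hκ
  · -- `τ s = -s = s`
    have hneg : τ s = -s := eq_neg_of_add_eq_zero_right h0
    have hss : -s = s := by
      rw [neg_eq_iff_add_eq_zero, ← two_nsmul]
      exact h2 s hs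
    exact hinv s hs (by rw [hneg, hss])
  · exact absurd hκ (htr s hs)

/-- Cardinality form: under the hypotheses of `selmer_eq_zero_or_eq_of_invariants_of_not_trace`
with `κ ∈ S`, `κ ≠ 0`, the subgroup `S` has exactly two elements. [folklore] -/
theorem natCard_eq_two_of_invariants_of_not_trace (S : AddSubgroup V) (τ : V →+ V)
    (hτ2 : ∀ x, τ (τ x) = x) (hτS : ∀ s ∈ S, τ s ∈ S) (h2 : ∀ x ∈ S, (2 : ℕ) • x = 0)
    {κ : V} (hκ : κ ∈ S) (hκ0 : κ ≠ 0) (hinv : ∀ s ∈ S, τ s = s → s = 0 ∨ s = κ)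
    (htr : ∀ s ∈ S, s + τ s ≠ κ) : Nat.card S = 2 := by
  have hsub := selmer_eq_zero_or_eq_of_invariants_of_not_trace S τ hτ2 hτS h2 hinv htr
  have hST : (S : Set V) = {0, κ} := by
    ext x
    simp only [SetLike.mem_coe, Set.mem_insert_iff, Set.mem_singleton_iff]
    constructor
    · exact hsub x
    · rintro (rfl | rfl)
      · exact S.zero_mem
      · exact hκ
  rw [← SetLike.coe_sort_coe, hST, Nat.card_coe_set_eq, Set.ncard_pair hκ0.symm]

end Assembly

/-! ## §4 Instantiation on `Sel^(2)(E/K) ⊆ H¹(K, E[2])` with `τ = conjAct` -/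

section Selmer

open Literature.NumberTheory.EllipticCurves WeierstrassCurve

variable (W : WeierstrassCurve ℚ) (K : Type) [Field K] [NumberField K]

/-- `H¹(K, E[2])` is killed by `2`. [folklore] -/
theorem two_nsmul_galH1Torsion_two (x : galH1Torsion (W.baseChange K) 2) : (2 : ℕ) • x = 0 := by
  have h := zsmul_discreteH1_torsion (2 : ℤ) x
  rw [← natCast_zsmul]
  exact_mod_cast h

/-- **Gross's Prop. 2.3 at `p = 2`, assembled from its two halves.** `K` a number field all of
whose infinite places are complex (imaginary quadratic), `c ∈ Aut(K/ℚ)` an involution (complex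
conjugation), `τ = c_*` on `H¹(K, E[2])` (`conjAct`, Gross §5), `κ ∈ Sel^(2)(E/K)` (the class
`δ y_K`). IF (i) the `τ`-invariant Selmer classes are `0` and `κ` only — the `ℚ`-side statement
about the pair `(E, E^{(d_K)})` — and (ii) `κ ∉ (1 + τ) Sel^(2)(E/K)` — the transposition-prime
statement — THEN `Sel^(2)(E/K) ⊆ {0, κ}`. [cite: GrossLMS1991, §2 Prop. 2.3 and §10] -/
theorem selmerGroup_two_subset_pair_of_invariants_of_not_trace
    (hK : ∀ w : NumberField.InfinitePlace K, w.IsComplex) (c : K ≃ₐ[ℚ] K) (hc : c * c = 1)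
    {κ : galH1Torsion (W.baseChange K) 2}
    (hinv : ∀ s ∈ selmerGroup (W.baseChange K) 2, conjAct W c 2 s = s → s = 0 ∨ s = κ)
    (htr : ∀ s ∈ selmerGroup (W.baseChange K) 2, s + conjAct W c 2 s ≠ κ) :
    ∀ s ∈ selmerGroup (W.baseChange K) 2, s = 0 ∨ s = κ :=
  selmer_eq_zero_or_eq_of_invariants_of_not_trace (selmerGroup (W.baseChange K) 2)
    (conjAct W c 2) (conjAct_conjAct_of_mul_self W hc 2)
    (fun _ hs ↦ conjAct_mem_selmerGroup W hK c 2 hs)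
    (fun x _ ↦ two_nsmul_galH1Torsion_two W K x) hinv htr

/-- Cardinality form of the assembly: `#Sel^(2)(E/K) = 2`, the `p = 2` reading of the tree's
`Gross1991_prop_2_3` conclusion `Nat.card (selmerGroup _ p) = p`. [cite: GrossLMS1991, §2 Prop. 2.3] -/
theorem natCard_selmerGroup_two_eq_two_of_invariants_of_not_trace
    (hK : ∀ w : NumberField.InfinitePlace K, w.IsComplex) (c : K ≃ₐ[ℚ] K) (hc : c * c = 1)
    {κ : galH1Torsion (W.baseChange K) 2} (hκ : κ ∈ selmerGroup (W.baseChange K) 2) (hκ0 : κ ≠ 0)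
    (hinv : ∀ s ∈ selmerGroup (W.baseChange K) 2, conjAct W c 2 s = s → s = 0 ∨ s = κ)
    (htr : ∀ s ∈ selmerGroup (W.baseChange K) 2, s + conjAct W c 2 s ≠ κ) :
    Nat.card (selmerGroup (W.baseChange K) 2) = 2 :=
  natCard_eq_two_of_invariants_of_not_trace (selmerGroup (W.baseChange K) 2)
    (conjAct W c 2) (conjAct_conjAct_of_mul_self W hc 2)
    (fun _ hs ↦ conjAct_mem_selmerGroup W hK c 2 hs)
    (fun x _ ↦ two_nsmul_galH1Torsion_two W K x) hκ hκ0 hinv htr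

end Selmer


/-! ## §5 (APPEND 1, memo v5.1 §9–§10) The membership skeleton: `(1 + τ)s` dies locally at an
admissible place; (F4) and (F4′) from leaves stated with local KERNELS only

The values `loc_λ s ∈ H¹_f(K_λ, E[2])` of §2–§4 are not needed: everything can be said with the
local kernel `T = ker (H¹(K, E[2]) → H¹(K_λ, E[2]))` (the tree's `torsionLocalKer`, the "`s_λ = 0`" of
Gross Prop. 8.2 / 9.6). The hyperplane constraint (HYP) of memo §4 reads «`s ∈ T ∨ s − κ ∈ T` for every
Selmer `s`», admissibility reads «`κ ∉ T`», and the Frobenius twist `loc(τ s) = w · loc(s)` is only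
used through the TRANSPORT «`x ∈ T → τ x ∈ T`» at the `τ`-stable place `λ` (the relation `w t = t`
becomes `τ κ = κ`). -/

section Membership

variable {V : Type*} [AddCommGroup V]

/-- **`(1 + τ)s` is locally trivial at an admissible place.** `T ≤ V` a subgroup (a local kernel),
`τ` additive with `τ(T) ⊆ T` (transport at a `τ`-stable place) and `τ κ = κ`, `2κ = 0`. If
`s ∈ T ∨ s − κ ∈ T` (the hyperplane constraint for `s`) then `s + τ s ∈ T`: either both `s, τ s ∈ T`,
or `s − κ, τ s − κ ∈ T` and `s + τ s = (s − κ) + (τ s − κ) + 2κ`. [cite: GrossLMS1991, §9] -/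
theorem add_apply_mem_of_mem_or_sub_mem (T : AddSubgroup V) (τ : V →+ V)
    (hT : ∀ x ∈ T, τ x ∈ T) {κ : V} (hτκ : τ κ = κ) (h2κ : (2 : ℕ) • κ = 0) {s : V}
    (hyp : s ∈ T ∨ s - κ ∈ T) : s + τ s ∈ T := by
  rcases hyp with hs | hs
  · exact T.add_mem hs (hT s hs)
  · have h1 : τ s - κ ∈ T := by
      have := hT _ hs
      rwa [map_sub, hτκ] at this
    have h2 : s + τ s = (s - κ) + (τ s - κ) + (2 : ℕ) • κ := by
      rw [two_nsmul]; abel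
    rw [h2, h2κ, add_zero]
    exact T.add_mem hs h1

/-- **(F4) from kernels.** At a place with transport, `τ κ = κ`, `2κ = 0`, the hyperplane constraint for
`s` and ADMISSIBILITY `κ ∉ T`: `s + τ s ≠ κ`. [cite: GrossLMS1991, §9 and §10] -/
theorem add_apply_ne_of_not_mem (T : AddSubgroup V) (τ : V →+ V) (hT : ∀ x ∈ T, τ x ∈ T)
    {κ : V} (hτκ : τ κ = κ) (h2κ : (2 : ℕ) • κ = 0) (hκT : κ ∉ T) {s : V}
    (hyp : s ∈ T ∨ s - κ ∈ T) : s + τ s ≠ κ := fun h ↦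
  hκT (h ▸ add_apply_mem_of_mem_or_sub_mem T τ hT hτκ h2κ hyp)

/-- **(F4′) from kernels: `Gal(K/ℚ)` acts trivially on the Selmer group.** `S ≤ V` killed by `2`,
`τ` an additive map with `τ κ = κ`. Suppose that for every `s ∈ S` with `s + τ s ≠ 0` there is a local
kernel `T` (an admissible place, chosen by Čebotarev for the pair `(κ, s + τ s)`) with transport
`τ(T) ⊆ T`, admissibility `κ ∉ T`, the hyperplane constraint for `s`, and `s + τ s ∉ T` unless
`s + τ s = κ`. Then `τ s = s` for every `s ∈ S`. [cite: GrossLMS1991, §10] [cite: McCallumLMS1991, Cor. 3.2] -/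
theorem apply_eq_self_of_admissible (S : AddSubgroup V) (τ : V →+ V) (h2 : ∀ x ∈ S, (2 : ℕ) • x = 0)
    {κ : V} (hκ : κ ∈ S) (hτκ : τ κ = κ)
    (hadm : ∀ s ∈ S, s + τ s ≠ 0 → ∃ T : AddSubgroup V,
      (∀ x ∈ T, τ x ∈ T) ∧ κ ∉ T ∧ (s ∈ T ∨ s - κ ∈ T) ∧ (s + τ s ∈ T → s + τ s = κ)) :
    ∀ s ∈ S, τ s = s := by
  intro s hs
  by_contra hne
  have hne0 : s + τ s ≠ 0 := by
    intro h0
    apply hne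
    have hneg : τ s = -s := eq_neg_of_add_eq_zero_right h0
    rw [hneg, neg_eq_iff_add_eq_zero, ← two_nsmul]
    exact h2 s hs
  obtain ⟨T, hT, hκT, hyp, hstrict⟩ := hadm s hs hne0
  have hmem := add_apply_mem_of_mem_or_sub_mem T τ hT hτκ (h2 κ hκ) hyp
  exact add_apply_ne_of_not_mem T τ hT hτκ (h2 κ hκ) hκT hyp (hstrict hmem)

/-- With `τ` trivial on `S` and the `τ`-invariants of `S` inside `{0, κ}` (the `ℚ`-side input, memo
§10: on the habitat `dim Sel₂(E/K)^τ = DEF(E,K)`), `S ⊆ {0, κ}`. [folklore] -/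
theorem eq_zero_or_eq_of_apply_eq_self (S : AddSubgroup V) (τ : V →+ V) {κ : V}
    (hfix : ∀ s ∈ S, τ s = s) (hinv : ∀ s ∈ S, τ s = s → s = 0 ∨ s = κ) :
    ∀ s ∈ S, s = 0 ∨ s = κ :=
  fun s hs ↦ hinv s hs (hfix s hs)

end Membership

/-! ## §6 (APPEND 1) The concrete form on `Sel^(2)(E/K)` with the tree's local kernels

`T_v = (W.baseChange K).torsionLocalKer (v.adicCompletion K) 2` ("`s_v = 0` in `H¹(K_v, E[2])`"),
`τ = conjAct W c 2`. The displayed inputs per admissible place `v = λ` are exactly the `p = 2` leaves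
of memo v5 §8: TRANSPORT (`conjAct` preserves `T_λ` at the `c`-stable inert place — folklore, cf. the
tree's `conjAct_mem_selmerLocalKer_iff` for the Selmer kernel), ADMISSIBILITY (`κ ∉ T_λ`, i.e.
`ỹ_K ∉ 2Ẽ(𝔽_λ)` by the local criterion `mem_torsionLocalKer_iff_h1Eval_eq_zero` of
`HeegnerPointsKolyvaginLocalCriterion`), the HYPERPLANE CONSTRAINT (Kolyvagin's class `c(ℓ)` at a
parity-type transposition prime + duality over `K`, §2–§4), and the ČEBOTAREV choice for the pair
`(κ, s + τ s)` (§9, both parity types). -/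

section SelmerKernels

open Literature.NumberTheory.EllipticCurves WeierstrassCurve IsDedekindDomain NumberField

variable (W : WeierstrassCurve ℚ) (K : Type) [Field K] [NumberField K]

/-- **(F4) on `Sel^(2)(E/K)`**: given ONE admissible place `v` (transport, `κ ∉ T_v`, hyperplane
constraint for `s`), a Selmer class `s` with `τ κ = κ` cannot have `s + τ s = κ`.
[cite: GrossLMS1991, §10] -/
theorem selmer_two_add_conjAct_ne (c : K ≃ₐ[ℚ] K) (v : HeightOneSpectrum (𝓞 K))
    {κ s : galH1Torsion (W.baseChange K) 2} (hτκ : conjAct W c 2 κ = κ)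
    (hT : ∀ x ∈ (W.baseChange K).torsionLocalKer (v.adicCompletion K) 2,
      conjAct W c 2 x ∈ (W.baseChange K).torsionLocalKer (v.adicCompletion K) 2)
    (hκT : κ ∉ (W.baseChange K).torsionLocalKer (v.adicCompletion K) 2)
    (hyp : s ∈ (W.baseChange K).torsionLocalKer (v.adicCompletion K) 2 ∨
      s - κ ∈ (W.baseChange K).torsionLocalKer (v.adicCompletion K) 2) :
    s + conjAct W c 2 s ≠ κ :=
  add_apply_ne_of_not_mem _ (conjAct W c 2) hT hτκ (two_nsmul_galH1Torsion_two W K κ) hκT hyp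

/-- **(F4′) on `Sel^(2)(E/K)`: `Gal(K/ℚ)` acts trivially**, granted for every Selmer class `s` with
`s + τ s ≠ 0` an admissible place `v` for the pair `(κ, s + τ s)`.
[cite: GrossLMS1991, §10] [cite: McCallumLMS1991, Cor. 3.2] -/
theorem conjAct_eq_self_of_admissible (c : K ≃ₐ[ℚ] K)
    {κ : galH1Torsion (W.baseChange K) 2} (hκ : κ ∈ selmerGroup (W.baseChange K) 2)
    (hτκ : conjAct W c 2 κ = κ)
    (hadm : ∀ s ∈ selmerGroup (W.baseChange K) 2, s + conjAct W c 2 s ≠ 0 →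
      ∃ v : HeightOneSpectrum (𝓞 K),
        (∀ x ∈ (W.baseChange K).torsionLocalKer (v.adicCompletion K) 2,
          conjAct W c 2 x ∈ (W.baseChange K).torsionLocalKer (v.adicCompletion K) 2) ∧
        κ ∉ (W.baseChange K).torsionLocalKer (v.adicCompletion K) 2 ∧
        (s ∈ (W.baseChange K).torsionLocalKer (v.adicCompletion K) 2 ∨
          s - κ ∈ (W.baseChange K).torsionLocalKer (v.adicCompletion K) 2) ∧
        (s + conjAct W c 2 s ∈ (W.baseChange K).torsionLocalKer (v.adicCompletion K) 2 →
          s + conjAct W c 2 s = κ)) :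
    ∀ s ∈ selmerGroup (W.baseChange K) 2, conjAct W c 2 s = s := by
  refine apply_eq_self_of_admissible (selmerGroup (W.baseChange K) 2) (conjAct W c 2)
    (fun x _ ↦ two_nsmul_galH1Torsion_two W K x) hκ hτκ fun s hs hne ↦ ?_
  obtain ⟨v, h1, h2, h3, h4⟩ := hadm s hs hne
  exact ⟨_, h1, h2, h3, h4⟩

/-- **Gross's Prop. 2.3 at `p = 2` from the two halves, kernel form.** (F4′) (admissible places for
all Selmer classes) and the `ℚ`-side input «`τ`-invariant Selmer classes are `0` or `κ`» (memo v5.1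
§10: on the habitat this is `DEF(E,K) = 1`) give `Sel^(2)(E/K) ⊆ {0, κ}`, hence `#Sel^(2)(E/K) = 2`
when `κ ≠ 0`. [cite: GrossLMS1991, §2 Prop. 2.3] -/
theorem natCard_selmerGroup_two_eq_two_of_admissible (c : K ≃ₐ[ℚ] K)
    {κ : galH1Torsion (W.baseChange K) 2} (hκ : κ ∈ selmerGroup (W.baseChange K) 2) (hκ0 : κ ≠ 0)
    (hτκ : conjAct W c 2 κ = κ)
    (hadm : ∀ s ∈ selmerGroup (W.baseChange K) 2, s + conjAct W c 2 s ≠ 0 →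
      ∃ v : HeightOneSpectrum (𝓞 K),
        (∀ x ∈ (W.baseChange K).torsionLocalKer (v.adicCompletion K) 2,
          conjAct W c 2 x ∈ (W.baseChange K).torsionLocalKer (v.adicCompletion K) 2) ∧
        κ ∉ (W.baseChange K).torsionLocalKer (v.adicCompletion K) 2 ∧
        (s ∈ (W.baseChange K).torsionLocalKer (v.adicCompletion K) 2 ∨
          s - κ ∈ (W.baseChange K).torsionLocalKer (v.adicCompletion K) 2) ∧
        (s + conjAct W c 2 s ∈ (W.baseChange K).torsionLocalKer (v.adicCompletion K) 2 →
          s + conjAct W c 2 s = κ))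
    (hinv : ∀ s ∈ selmerGroup (W.baseChange K) 2, conjAct W c 2 s = s → s = 0 ∨ s = κ) :
    Nat.card (selmerGroup (W.baseChange K) 2) = 2 := by
  have hfix := conjAct_eq_self_of_admissible W K c hκ hτκ hadm
  have hsub := eq_zero_or_eq_of_apply_eq_self (selmerGroup (W.baseChange K) 2) (conjAct W c 2)
    hfix hinv
  have hST : ((selmerGroup (W.baseChange K) 2 : AddSubgroup _) : Set _) = {0, κ} := by
    ext x
    simp only [SetLike.mem_coe, Set.mem_insert_iff, Set.mem_singleton_iff]
    exact ⟨hsub x, by rintro (rfl | rfl); exacts [AddSubgroup.zero_mem _, hκ]⟩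
  rw [← SetLike.coe_sort_coe, hST, Nat.card_coe_set_eq, Set.ncard_pair hκ0.symm]

end SelmerKernels

end Summit.BirchSwinnertonDyer.BirchSwinnertonDyer.Theorems.GenusExact
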